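import Summits.AtomisticToContinuum.Crystallization.Theorems.ChargedEnergyGapGridFrameA
import HarnessLib

/-!
# ChargedEnergyGap · 113N «GridFrame» (typed top-level cover + law-level tiling; lens-3 g96) — part B (sequel of `…ChargedEnergyGapGridFrameA`)

Split for the 400-line cap by the landing lane (hand-2 g49); the module docstring of part A describes the whole node.  Same namespace; all FQNs unchanged.
0 sorry; standard axioms.
-/


namespace Summit.AtomisticToContinuum.Crystallization.Theorems.ChargedEnergyGapChartDial
open scoped Classical
open Literature.MathematicalPhysics.StatisticalMechanics Literature.Geometry.DiscreteGeometry
open Summit.AtomisticToContinuum.Crystallization.Theses.PricedLinkCensus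
open Summit.AtomisticToContinuum.Crystallization.Theorems.ChargedEnergyGapNegative

/-! ## §113N.5 ★★★ The top-level cover theorem: a checked grid of frame laws gives the chart law (T¹ᶜ) -/
section Cover

/-- ★ THE ROOT BOX of the grid for `ρ ∈ [ρlo, ρhi]` and admissibility depth `dK`: the a-priori ranges `T₀, F₀, C ∈ [187/2, dK + 2ρhi]`
(`mem_rootBox`). -/
def rootBox (dK ρlo ρhi : ℚ) : GBox := ⟨ρlo, ρhi, 187 / 2, dK + 2 * ρhi, 187 / 2, dK + 2 * ρhi, 187 / 2, dK + 2 * ρhi⟩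

/-- ★ Every admissible point lies in the root box. -/
theorem mem_rootBox {dK ρlo ρhi : ℚ} {ρ T F C : ℝ} (h₁ : (ρlo : ℝ) ≤ ρ) (h₂ : ρ ≤ ρhi) (hρ : 0 ≤ ρ)
    (hTF : T ≤ F) (hClo : (T + F + ρ) / 2 ≤ C) (hChi : C ≤ T + ρ) (hT935 : (187 / 2 : ℝ) ≤ T) (hCdK : C - ρ < dK) :
    (((rootBox dK ρlo ρhi).r0 : ℝ) ≤ ρ ∧ ρ ≤ (rootBox dK ρlo ρhi).r1 ∧ ((rootBox dK ρlo ρhi).t0 : ℝ) ≤ T ∧ T ≤ (rootBox dK ρlo ρhi).t1 ∧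
      ((rootBox dK ρlo ρhi).f0 : ℝ) ≤ F ∧ F ≤ (rootBox dK ρlo ρhi).f1 ∧ ((rootBox dK ρlo ρhi).c0 : ℝ) ≤ C ∧ C ≤ (rootBox dK ρlo ρhi).c1) := by
  simp only [rootBox]
  refine ⟨h₁, h₂, ?_, ?_, ?_, ?_, ?_, ?_⟩ <;> push_cast <;> linarith

/-- ★★★ **THE GRID COVER THEOREM.**  If a grid tree over the root box checks against the frame list (`decide +kernel` in the assembly file) and
every frame carries its FRAME LAW (the conclusion of 113L `ZUnit.soundM` / 113M `TileUnit.sound` for that H-description and the unit `u`), then the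
stencil chart law (T¹ᶜ) holds on `[ρlo, ρhi]` with admissibility depth `dK`, law constants `(160, 3/100)` and unit `u`.
PROOF: `stencilChartLawQ_of_fullNormalForm` (111) ∘ the a-priori rows (§113N.1, 113C) ∘ `GridTree.check_sound` ∘ `StationRowsCert.box_of_coversG`. -/
theorem stencilChartLawQ_of_grid {dK ρlo ρhi u : ℚ} (hρ : 0 < ρlo) (frames : List StationRowsCert) (G : GridTree)
    (hG : G.check dK frames (rootBox dK ρlo ρhi) = true)
    (hlaws : ∀ R ∈ frames, ∀ ρ : ℝ, (R.rho0 : ℝ) ≤ ρ → ρ ≤ R.rho1 → ∀ dt : (Fin 3 → ℤ) → ℝ,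
      (∀ q, castW R.lo q ≤ dt (holeVertex 0 q) ∧ dt (holeVertex 0 q) ≤ castW R.hi q) → ((R.loC : ℝ) ≤ dt 0 ∧ dt 0 ≤ R.hiC) →
      IsChartRealisable ρ dt → (∀ p ∈ stencil 0, 0 < dt p) → poleSum dt 0 ≤ poleSum dt 1 → poleSum dt 0 ≤ poleSum dt 2 →
      (∀ a : Fin 3, dt (holeVertex 0 (a, true)) ≤ dt (holeVertex 0 (a, false))) →
      feetHoleCost 160 (3 / 100) ρ dt 0 ≤ domCapK u 160 (3 / 100) ρ (chargeDepth ρ dt 0)) :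
    StencilChartLawQ dK u 160 (3 / 100) ρlo ρhi := by
  refine stencilChartLawQ_of_fullNormalForm (by exact_mod_cast hρ) fun ρ h₁ h₂ dt hch1 hch2 hchp hpos hreal hhole => ?_
  have hρ0 : (0 : ℝ) < ρ := lt_of_lt_of_le (by exact_mod_cast hρ) h₁
  have hTF : dt (holeVertex 0 (0, true)) ≤ dt (holeVertex 0 (0, false)) := hchp 0
  have hClo : (dt (holeVertex 0 (0, true)) + dt (holeVertex 0 (0, false)) + ρ) / 2 ≤ dt 0 :=
    centre_lower_of_box hρ0 le_rfl hhole hch1 hch2 le_rfl le_rfl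
  have hChi : dt 0 ≤ dt (holeVertex 0 (0, true)) + ρ :=
    centre_upper_of_chart hρ0.le hreal (0, true) (hpos _ (mem_stencil_vertex 0 (0, true))).le
  have hT935 : (187 / 2 : ℝ) ≤ dt (holeVertex 0 (0, true)) := vertex_ge_of_hole hhole (0, true)
  have hCdK : dt 0 - ρ < dK := centre_sub_lt_of_hole hρ0.le hhole hreal hpos
  have hroot := mem_rootBox (dK := dK) h₁ h₂ hρ0.le hTF hClo hChi hT935 hCdK
  obtain ⟨R, hR, B, hcov, hm⟩ := GridTree.check_sound dK frames hTF hClo hChi hT935 hCdK G _ hG hroot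
  obtain ⟨⟨e0, e1⟩, hbox, hcen⟩ := StationRowsCert.box_of_coversG hcov hρ0.le hreal hpos hch1 hch2 hchp hm
  exact hlaws R hR ρ e0 e1 dt hbox hcen hreal hpos hch1 hch2 hchp

/-- ★★★ **(T¹ᶜ) FROM A CHECKED GRID OF FRAME LAWS** — the designate of 14231: `dK = 130`, unit `1/60000000`, `ρ ∈ [679/1000, 691/1000]`.
The frame laws are exactly what the landed units prove (`…ZB*W*.U_law`, via `ZUnit.frameLaw`); open frames stay hypotheses = named UNDECIDED leaves. -/
theorem stencilChartLawQ_designate_of_grid (frames : List StationRowsCert) (G : GridTree)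
    (hG : G.check 130 frames (rootBox 130 (679 / 1000) (691 / 1000)) = true)
    (hlaws : ∀ R ∈ frames, ∀ ρ : ℝ, (R.rho0 : ℝ) ≤ ρ → ρ ≤ R.rho1 → ∀ dt : (Fin 3 → ℤ) → ℝ,
      (∀ q, castW R.lo q ≤ dt (holeVertex 0 q) ∧ dt (holeVertex 0 q) ≤ castW R.hi q) → ((R.loC : ℝ) ≤ dt 0 ∧ dt 0 ≤ R.hiC) →
      IsChartRealisable ρ dt → (∀ p ∈ stencil 0, 0 < dt p) → poleSum dt 0 ≤ poleSum dt 1 → poleSum dt 0 ≤ poleSum dt 2 →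
      (∀ a : Fin 3, dt (holeVertex 0 (a, true)) ≤ dt (holeVertex 0 (a, false))) →
      feetHoleCost 160 (3 / 100) ρ dt 0 ≤ domCapK ((1 / 60000000 : ℚ) : ℝ) 160 (3 / 100) ρ (chargeDepth ρ dt 0)) :
    StencilChartLawQ 130 (1 / 60000000) 160 (3 / 100) (679 / 1000) (691 / 1000) := by
  have h := stencilChartLawQ_of_grid (dK := 130) (ρlo := 679 / 1000) (ρhi := 691 / 1000) (u := 1 / 60000000) (by norm_num) frames G hG hlaws
  norm_num at h
  exact h

/-- ★ CONSUMING A LANDED 113L UNIT AS A FRAME LAW BY NAME: a mirror-checked flat unit whose H-description and unit are the frame's. -/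
theorem ZUnit.frameLaw (U : ZUnit) (h : U.checkM = true) {R : StationRowsCert} {u : ℚ} (hR : U.R = R) (hu : U.u = u) :
    ∀ ρ : ℝ, (R.rho0 : ℝ) ≤ ρ → ρ ≤ R.rho1 → ∀ dt : (Fin 3 → ℤ) → ℝ,
      (∀ q, castW R.lo q ≤ dt (holeVertex 0 q) ∧ dt (holeVertex 0 q) ≤ castW R.hi q) → ((R.loC : ℝ) ≤ dt 0 ∧ dt 0 ≤ R.hiC) →
      IsChartRealisable ρ dt → (∀ p ∈ stencil 0, 0 < dt p) → poleSum dt 0 ≤ poleSum dt 1 → poleSum dt 0 ≤ poleSum dt 2 →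
      (∀ a : Fin 3, dt (holeVertex 0 (a, true)) ≤ dt (holeVertex 0 (a, false))) →
      feetHoleCost 160 (3 / 100) ρ dt 0 ≤ domCapK u 160 (3 / 100) ρ (chargeDepth ρ dt 0) := by
  subst hR hu
  exact U.soundM h

end Cover

/-! ## §113N.6 Law-level TILING of a frame in the transverse coordinates (landed tile units are reusable as tiles) -/
section Tiles

/-- ★ A TRANSVERSE BOX: ranges of the four transverse hole-vertex depths `T₁ = dt(e₁⁺)`, `F₁ = dt(e₁⁻)`, `T₂ = dt(e₂⁺)`, `F₂ = dt(e₂⁻)`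
(exact rationals).  These are NOT grid coordinates: a frame of the grid must carry the whole transverse envelope of its grid box; a unit
certified on a transverse TILE only (the `ZB2a/ZB2b` T-halves, the `ZB3` quarter tiles) becomes a frame law through `law_of_tiles`. -/
structure TBox where
  /-- `T₁` range, low end -/
  t1lo : ℚ
  /-- `T₁` range, high end -/
  t1hi : ℚ
  /-- `F₁` range, low end -/
  f1lo : ℚ
  /-- `F₁` range, high end -/
  f1hi : ℚ
  /-- `T₂` range, low end -/
  t2lo : ℚ
  /-- `T₂` range, high end -/
  t2hi : ℚ
  /-- `F₂` range, low end -/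
  f2lo : ℚ
  /-- `F₂` range, high end -/
  f2hi : ℚ

/-- The transverse box of an H-description (slots `(1,±)`, `(2,±)`). -/
def StationRowsCert.tbox (R : StationRowsCert) : TBox :=
  ⟨R.lo (1, true), R.hi (1, true), R.lo (1, false), R.hi (1, false), R.lo (2, true), R.hi (2, true), R.lo (2, false), R.hi (2, false)⟩

/-- ★ TILE CONTAINMENT (decidable, exact ℚ): the tile H-description `S` is at least as wide as the frame `R` on the slab, slot `0` and the
centre, and contains the transverse box `X`. -/
def StationRowsCert.coversT (R S : StationRowsCert) (X : TBox) : Bool :=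
  decide (S.rho0 ≤ R.rho0 ∧ R.rho1 ≤ S.rho1 ∧ S.lo (0, true) ≤ R.lo (0, true) ∧ R.hi (0, true) ≤ S.hi (0, true) ∧
    S.lo (0, false) ≤ R.lo (0, false) ∧ R.hi (0, false) ≤ S.hi (0, false) ∧ S.loC ≤ R.loC ∧ R.hiC ≤ S.hiC ∧
    S.lo (1, true) ≤ X.t1lo ∧ X.t1hi ≤ S.hi (1, true) ∧ S.lo (1, false) ≤ X.f1lo ∧ X.f1hi ≤ S.hi (1, false) ∧
    S.lo (2, true) ≤ X.t2lo ∧ X.t2hi ≤ S.hi (2, true) ∧ S.lo (2, false) ≤ X.f2lo ∧ X.f2hi ≤ S.hi (2, false))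

/-- ★ VACUOUS TILE: an empty range, or the pole order `T_a ≤ F_a` fails throughout the tile. -/
def TBox.isOff (X : TBox) : Bool :=
  decide (X.t1hi < X.t1lo ∨ X.f1hi < X.f1lo ∨ X.t2hi < X.t2lo ∨ X.f2hi < X.f2lo ∨ X.f1hi < X.t1lo ∨ X.f2hi < X.t2lo)

/-- ★ A vacuous tile has no (pole-ordered) points. -/
theorem TBox.not_mem_of_isOff {X : TBox} (h : X.isOff = true) {T1 F1 T2 F2 : ℝ} (hp1 : T1 ≤ F1) (hp2 : T2 ≤ F2)
    (hm : (X.t1lo : ℝ) ≤ T1 ∧ T1 ≤ X.t1hi ∧ (X.f1lo : ℝ) ≤ F1 ∧ F1 ≤ X.f1hi ∧ (X.t2lo : ℝ) ≤ T2 ∧ T2 ≤ X.t2hi ∧ (X.f2lo : ℝ) ≤ F2 ∧ F2 ≤ X.f2hi) :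
    False := by
  obtain ⟨a1, a2, a3, a4, a5, a6, a7, a8⟩ := hm
  simp only [TBox.isOff, decide_eq_true_eq] at h
  rcases h with h | h | h | h | h | h <;> (have h' := (Rat.cast_lt (K := ℝ)).2 h; linarith)

/-- ★ A TILE TREE: binary space partition of a transverse box; a leaf is a tile index (into the tile list) or `off` (vacuous). -/
inductive LawTile where
  /-- leaf: the transverse box lies in the tile `tiles[j]` -/
  | tile (j : ℕ)
  /-- leaf: the transverse box is vacuous -/
  | off
  /-- split the `T₁` range at `m` -/
  | splitT1 (m : ℚ) (tlo thi : LawTile)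
  /-- split the `F₁` range at `m` -/
  | splitF1 (m : ℚ) (tlo thi : LawTile)
  /-- split the `T₂` range at `m` -/
  | splitT2 (m : ℚ) (tlo thi : LawTile)
  /-- split the `F₂` range at `m` -/
  | splitF2 (m : ℚ) (tlo thi : LawTile)

/-- ★ THE TILE CHECKER (Bool, exact ℚ; `decide +kernel`): every leaf of the partition of `X` lies in its tile or is vacuous. -/
def LawTile.check (R : StationRowsCert) (tiles : List StationRowsCert) : LawTile → TBox → Bool
  | .tile j, X =>
    match tiles[j]? with
    | some S => R.coversT S X
    | none => false
  | .off, X => X.isOff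
  | .splitT1 m tlo thi, X => tlo.check R tiles { X with t1hi := m } && thi.check R tiles { X with t1lo := m }
  | .splitF1 m tlo thi, X => tlo.check R tiles { X with f1hi := m } && thi.check R tiles { X with f1lo := m }
  | .splitT2 m tlo thi, X => tlo.check R tiles { X with t2hi := m } && thi.check R tiles { X with t2lo := m }
  | .splitF2 m tlo thi, X => tlo.check R tiles { X with f2hi := m } && thi.check R tiles { X with f2lo := m }

/-- ★★ THE TILE CHECKER IS SOUND: a pole-ordered point of a checked transverse box lies in a box contained in one of the tiles. -/
theorem LawTile.check_sound (R : StationRowsCert) (tiles : List StationRowsCert) {T1 F1 T2 F2 : ℝ} (hp1 : T1 ≤ F1) (hp2 : T2 ≤ F2) :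
    ∀ (t : LawTile) (X : TBox), t.check R tiles X = true →
      ((X.t1lo : ℝ) ≤ T1 ∧ T1 ≤ X.t1hi ∧ (X.f1lo : ℝ) ≤ F1 ∧ F1 ≤ X.f1hi ∧ (X.t2lo : ℝ) ≤ T2 ∧ T2 ≤ X.t2hi ∧ (X.f2lo : ℝ) ≤ F2 ∧ F2 ≤ X.f2hi) →
      ∃ S ∈ tiles, ∃ X' : TBox, R.coversT S X' = true ∧
        ((X'.t1lo : ℝ) ≤ T1 ∧ T1 ≤ X'.t1hi ∧ (X'.f1lo : ℝ) ≤ F1 ∧ F1 ≤ X'.f1hi ∧ (X'.t2lo : ℝ) ≤ T2 ∧ T2 ≤ X'.t2hi ∧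
          (X'.f2lo : ℝ) ≤ F2 ∧ F2 ≤ X'.f2hi) := by
  intro t
  induction t with
  | tile j =>
    intro X h hm
    simp only [LawTile.check] at h
    split at h
    · next S hS => exact ⟨S, List.mem_of_getElem? hS, X, h, hm⟩
    · exact absurd h Bool.false_ne_true
  | off =>
    intro X h hm
    exact (TBox.not_mem_of_isOff h hp1 hp2 hm).elim
  | splitT1 m tlo thi ihlo ihhi =>
    intro X h hm
    simp only [LawTile.check, Bool.and_eq_true] at h
    obtain ⟨a1, a2, a3, a4, a5, a6, a7, a8⟩ := hm
    rcases le_total T1 (m : ℝ) with hle | hle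
    · exact ihlo _ h.1 ⟨a1, hle, a3, a4, a5, a6, a7, a8⟩
    · exact ihhi _ h.2 ⟨hle, a2, a3, a4, a5, a6, a7, a8⟩
  | splitF1 m tlo thi ihlo ihhi =>
    intro X h hm
    simp only [LawTile.check, Bool.and_eq_true] at h
    obtain ⟨a1, a2, a3, a4, a5, a6, a7, a8⟩ := hm
    rcases le_total F1 (m : ℝ) with hle | hle
    · exact ihlo _ h.1 ⟨a1, a2, a3, hle, a5, a6, a7, a8⟩
    · exact ihhi _ h.2 ⟨a1, a2, hle, a4, a5, a6, a7, a8⟩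
  | splitT2 m tlo thi ihlo ihhi =>
    intro X h hm
    simp only [LawTile.check, Bool.and_eq_true] at h
    obtain ⟨a1, a2, a3, a4, a5, a6, a7, a8⟩ := hm
    rcases le_total T2 (m : ℝ) with hle | hle
    · exact ihlo _ h.1 ⟨a1, a2, a3, a4, a5, hle, a7, a8⟩
    · exact ihhi _ h.2 ⟨a1, a2, a3, a4, hle, a6, a7, a8⟩
  | splitF2 m tlo thi ihlo ihhi =>
    intro X h hm
    simp only [LawTile.check, Bool.and_eq_true] at h
    obtain ⟨a1, a2, a3, a4, a5, a6, a7, a8⟩ := hm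
    rcases le_total F2 (m : ℝ) with hle | hle
    · exact ihlo _ h.1 ⟨a1, a2, a3, a4, a5, a6, a7, hle⟩
    · exact ihhi _ h.2 ⟨a1, a2, a3, a4, a5, a6, hle, a8⟩

/-- ★★★ **A FRAME LAW FROM TILE LAWS.**  If a tile tree over the frame's transverse box checks against the tile list and every tile carries its
law, the frame `R` carries its law (case split on the tile containing `(T₁, F₁, T₂, F₂)`; the laws are the 113L/113M unit laws verbatim). -/
theorem StationRowsCert.law_of_tiles {R : StationRowsCert} {tiles : List StationRowsCert} {t : LawTile}
    (ht : t.check R tiles R.tbox = true) {u : ℚ}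
    (hlaws : ∀ S ∈ tiles, ∀ ρ : ℝ, (S.rho0 : ℝ) ≤ ρ → ρ ≤ S.rho1 → ∀ dt : (Fin 3 → ℤ) → ℝ,
      (∀ q, castW S.lo q ≤ dt (holeVertex 0 q) ∧ dt (holeVertex 0 q) ≤ castW S.hi q) → ((S.loC : ℝ) ≤ dt 0 ∧ dt 0 ≤ S.hiC) →
      IsChartRealisable ρ dt → (∀ p ∈ stencil 0, 0 < dt p) → poleSum dt 0 ≤ poleSum dt 1 → poleSum dt 0 ≤ poleSum dt 2 →
      (∀ a : Fin 3, dt (holeVertex 0 (a, true)) ≤ dt (holeVertex 0 (a, false))) →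
      feetHoleCost 160 (3 / 100) ρ dt 0 ≤ domCapK u 160 (3 / 100) ρ (chargeDepth ρ dt 0)) :
    ∀ ρ : ℝ, (R.rho0 : ℝ) ≤ ρ → ρ ≤ R.rho1 → ∀ dt : (Fin 3 → ℤ) → ℝ,
      (∀ q, castW R.lo q ≤ dt (holeVertex 0 q) ∧ dt (holeVertex 0 q) ≤ castW R.hi q) → ((R.loC : ℝ) ≤ dt 0 ∧ dt 0 ≤ R.hiC) →
      IsChartRealisable ρ dt → (∀ p ∈ stencil 0, 0 < dt p) → poleSum dt 0 ≤ poleSum dt 1 → poleSum dt 0 ≤ poleSum dt 2 →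
      (∀ a : Fin 3, dt (holeVertex 0 (a, true)) ≤ dt (holeVertex 0 (a, false))) →
      feetHoleCost 160 (3 / 100) ρ dt 0 ≤ domCapK u 160 (3 / 100) ρ (chargeDepth ρ dt 0) := by
  intro ρ h₀ h₁ dt hbox hC hreal hpos hch1 hch2 hchp
  have m1 := hbox (1, true)
  have m2 := hbox (1, false)
  have m3 := hbox (2, true)
  have m4 := hbox (2, false)
  have m0T := hbox (0, true)
  have m0F := hbox (0, false)
  simp only [castW_apply] at m1 m2 m3 m4 m0T m0F
  obtain ⟨S, hS, X, hcov, hX⟩ := LawTile.check_sound R tiles (hchp 1) (hchp 2) t R.tbox ht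
    ⟨m1.1, m1.2, m2.1, m2.2, m3.1, m3.2, m4.1, m4.2⟩
  obtain ⟨x1, x2, x3, x4, x5, x6, x7, x8⟩ := hX
  simp only [StationRowsCert.coversT, decide_eq_true_eq] at hcov
  obtain ⟨s0, s1, l0T, h0T, l0F, h0F, lC, hCC, l1T, h1T, l1F, h1F, l2T, h2T, l2F, h2F⟩ := hcov
  have e0 : ((S.rho0 : ℚ) : ℝ) ≤ (R.rho0 : ℝ) := by exact_mod_cast s0
  have e1 : ((R.rho1 : ℚ) : ℝ) ≤ (S.rho1 : ℝ) := by exact_mod_cast s1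
  have eC0 : ((S.loC : ℚ) : ℝ) ≤ (R.loC : ℝ) := by exact_mod_cast lC
  have eC1 : ((R.hiC : ℚ) : ℝ) ≤ (S.hiC : ℝ) := by exact_mod_cast hCC
  have g0T : ((S.lo (0, true) : ℚ) : ℝ) ≤ (R.lo (0, true) : ℝ) := by exact_mod_cast l0T
  have g1T : ((R.hi (0, true) : ℚ) : ℝ) ≤ (S.hi (0, true) : ℝ) := by exact_mod_cast h0T
  have g0F : ((S.lo (0, false) : ℚ) : ℝ) ≤ (R.lo (0, false) : ℝ) := by exact_mod_cast l0F
  have g1F : ((R.hi (0, false) : ℚ) : ℝ) ≤ (S.hi (0, false) : ℝ) := by exact_mod_cast h0F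
  have k1T : ((S.lo (1, true) : ℚ) : ℝ) ≤ (X.t1lo : ℝ) := by exact_mod_cast l1T
  have k2T : ((X.t1hi : ℚ) : ℝ) ≤ (S.hi (1, true) : ℝ) := by exact_mod_cast h1T
  have k1F : ((S.lo (1, false) : ℚ) : ℝ) ≤ (X.f1lo : ℝ) := by exact_mod_cast l1F
  have k2F : ((X.f1hi : ℚ) : ℝ) ≤ (S.hi (1, false) : ℝ) := by exact_mod_cast h1F
  have k3T : ((S.lo (2, true) : ℚ) : ℝ) ≤ (X.t2lo : ℝ) := by exact_mod_cast l2T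
  have k4T : ((X.t2hi : ℚ) : ℝ) ≤ (S.hi (2, true) : ℝ) := by exact_mod_cast h2T
  have k3F : ((S.lo (2, false) : ℚ) : ℝ) ≤ (X.f2lo : ℝ) := by exact_mod_cast l2F
  have k4F : ((X.f2hi : ℚ) : ℝ) ≤ (S.hi (2, false) : ℝ) := by exact_mod_cast h2F
  refine hlaws S hS ρ (e0.trans h₀) (h₁.trans e1) dt ?_ ⟨eC0.trans hC.1, hC.2.trans eC1⟩ hreal hpos hch1 hch2 hchp
  rintro ⟨a, b⟩
  simp only [castW_apply]
  have ha : a = 0 ∨ a = 1 ∨ a = 2 := by fin_cases a <;> simp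
  rcases ha with rfl | rfl | rfl <;> cases b
  · exact ⟨g0F.trans m0F.1, m0F.2.trans g1F⟩
  · exact ⟨g0T.trans m0T.1, m0T.2.trans g1T⟩
  · exact ⟨k1F.trans x3, x4.trans k2F⟩
  · exact ⟨k1T.trans x1, x2.trans k2T⟩
  · exact ⟨k3F.trans x7, x8.trans k4F⟩
  · exact ⟨k3T.trans x5, x6.trans k4T⟩

end Tiles

/-! ## §113N.7 The `1 ↔ 2` mirror of a frame law (a mixed tile's law gives its mirror's) -/
section Mirror

/-- The `1 ↔ 2` MIRROR of an H-description: transverse slots swapped (`relabel 1 0`, 113I), slab / slot `0` / centre unchanged. -/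
def StationRowsCert.swap12 (R : StationRowsCert) : StationRowsCert :=
  { R with lo := fun q => R.lo (relabel 1 0 q), hi := fun q => R.hi (relabel 1 0 q) }

/-- [finite check] the relabelling `(1, 0)` is an involution. -/
theorem relabel_one_zero_invol (q : Fin 3 × Bool) : relabel 1 0 (relabel 1 0 q) = q := by
  revert q; decide

/-- ★★ **THE MIRROR OF A FRAME LAW**: the law for `R` gives the law for `R.swap12` (transport along `tupleRelabel 1 0`, 111 «AxisWLOG»:
realisability, positivity, feet cost and charge depth are invariant, the chamber hypotheses and pole orders are permuted; cf. 113I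
`sound_dietSph_swap12`, which needs a SYMMETRIC box — here the box is mirrored instead). -/
theorem StationRowsCert.frameLaw_swap12 {R : StationRowsCert} (hρ0 : 0 < R.rho0) {u : ℚ}
    (H : ∀ ρ : ℝ, (R.rho0 : ℝ) ≤ ρ → ρ ≤ R.rho1 → ∀ dt : (Fin 3 → ℤ) → ℝ,
      (∀ q, castW R.lo q ≤ dt (holeVertex 0 q) ∧ dt (holeVertex 0 q) ≤ castW R.hi q) → ((R.loC : ℝ) ≤ dt 0 ∧ dt 0 ≤ R.hiC) →
      IsChartRealisable ρ dt → (∀ p ∈ stencil 0, 0 < dt p) → poleSum dt 0 ≤ poleSum dt 1 → poleSum dt 0 ≤ poleSum dt 2 →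
      (∀ a : Fin 3, dt (holeVertex 0 (a, true)) ≤ dt (holeVertex 0 (a, false))) →
      feetHoleCost 160 (3 / 100) ρ dt 0 ≤ domCapK u 160 (3 / 100) ρ (chargeDepth ρ dt 0)) :
    ∀ ρ : ℝ, (R.swap12.rho0 : ℝ) ≤ ρ → ρ ≤ R.swap12.rho1 → ∀ dt : (Fin 3 → ℤ) → ℝ,
      (∀ q, castW R.swap12.lo q ≤ dt (holeVertex 0 q) ∧ dt (holeVertex 0 q) ≤ castW R.swap12.hi q) →
      ((R.swap12.loC : ℝ) ≤ dt 0 ∧ dt 0 ≤ R.swap12.hiC) →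
      IsChartRealisable ρ dt → (∀ p ∈ stencil 0, 0 < dt p) → poleSum dt 0 ≤ poleSum dt 1 → poleSum dt 0 ≤ poleSum dt 2 →
      (∀ a : Fin 3, dt (holeVertex 0 (a, true)) ≤ dt (holeVertex 0 (a, false))) →
      feetHoleCost 160 (3 / 100) ρ dt 0 ≤ domCapK u 160 (3 / 100) ρ (chargeDepth ρ dt 0) := by
  intro ρ h₀ h₁ dt hbox hC hreal hpos hch1 hch2 hchp
  have hρ : (0 : ℝ) < ρ := lt_of_lt_of_le (by exact_mod_cast hρ0) h₀
  have hv : ∀ (a : Fin 3) (b : Bool), tupleRelabel 1 0 dt (holeVertex 0 (a, b)) = dt (holeVertex 0 (axp 1 a, b)) := fun a b => by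
    rw [tupleRelabel_vertex, relabel_one_zero]
  have h0 : tupleRelabel 1 0 dt 0 = dt 0 := tupleRelabel_zero 1 0 dt
  have hp0 : poleSum (tupleRelabel 1 0 dt) 0 = poleSum dt 0 := by rw [poleSum_tupleRelabel, axp_one.1]
  have hp1 : poleSum (tupleRelabel 1 0 dt) 1 = poleSum dt 2 := by rw [poleSum_tupleRelabel, axp_one.2.1]
  have hp2 : poleSum (tupleRelabel 1 0 dt) 2 = poleSum dt 1 := by rw [poleSum_tupleRelabel, axp_one.2.2]
  have hbox' : ∀ q, castW R.lo q ≤ tupleRelabel 1 0 dt (holeVertex 0 q) ∧ tupleRelabel 1 0 dt (holeVertex 0 q) ≤ castW R.hi q := by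
    intro q
    have hb := hbox (relabel 1 0 q)
    simp only [castW_apply, StationRowsCert.swap12, relabel_one_zero_invol] at hb
    rw [tupleRelabel_vertex, castW_apply, castW_apply]
    exact hb
  have hC' : (R.loC : ℝ) ≤ tupleRelabel 1 0 dt 0 ∧ tupleRelabel 1 0 dt 0 ≤ R.hiC := by rw [h0]; exact hC
  have hchp' : ∀ a : Fin 3, tupleRelabel 1 0 dt (holeVertex 0 (a, true)) ≤ tupleRelabel 1 0 dt (holeVertex 0 (a, false)) := fun a => by
    rw [hv, hv]; exact hchp (axp 1 a)
  have hlaw := H ρ h₀ h₁ (tupleRelabel 1 0 dt) hbox' hC' (isChartRealisable_tupleRelabel 1 0 hreal) (pos_tupleRelabel 1 0 hpos)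
    (by rw [hp0, hp1]; exact hch2) (by rw [hp0, hp2]; exact hch1) hchp'
  rwa [feetHoleCost_tupleRelabel, chargeDepth_tupleRelabel 1 0 hρ.ne'] at hlaw

end Mirror

/-! ## §113N.8 Toy checks (`decide +kernel`), including the transverse-tile MUST-FAIL -/
section Toy

/-- Toy: the band box of W11 (`T₀, F₀ ∈ [118.113, 118.513]`), slab `[0.6865, 0.687]`, centre half-band `[118.642, 118.735]`. -/
def toyBandBox : GBox := ⟨1373 / 2000, 687 / 1000, 118113 / 1000, 118513 / 1000, 118113 / 1000, 118513 / 1000, 59321 / 500, 23747 / 200⟩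

/-- Toy frame: the BAND-WIDE H-description of that band (transverse `T_a ∈ [C−ρ, ⌈√(c1²+r1²)⌉] = [117.955, 118.737]`,
`F_a ∈ [max(C−ρ, (t0+f0)/2), c1+r1] = [118.113, 119.422]`). -/
def toyBandFrame : StationRowsCert :=
  { rho0 := 1373 / 2000, rho1 := 687 / 1000,
    lo := sextQ (118113 / 1000) (118113 / 1000) (117955 / 1000) (118113 / 1000) (117955 / 1000) (118113 / 1000),
    hi := sextQ (118513 / 1000) (118513 / 1000) (118737 / 1000) (119422 / 1000) (118737 / 1000) (119422 / 1000),
    loC := 59321 / 500, hiC := 23747 / 200, tangents := [], secants := [], s2 := [] }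

/-- Toy frame: the QUARTER-TILE H-description of the landed unit `ZB3W11L1t0f0.doorR` (transverse box of the quarter `T 0:1/2 × F 0:1/2` only). -/
def toyQuarterFrame : StationRowsCert :=
  { toyBandFrame with
    hi := sextQ (118513 / 1000) (118513 / 1000) (118346 / 1000) (118767 / 1000) (118346 / 1000) (118767 / 1000) }

/-- The band-wide frame covers the band box. -/
example : (GridTree.frame 0).check 130 [toyBandFrame] toyBandBox = true := by decide +kernel

/-- ★ MUST-FAIL (the transverse-tile gap at grid level): the quarter-tile H-description does NOT cover the band box. -/
example : (GridTree.frame 0).check 130 [toyQuarterFrame] toyBandBox = false := by decide +kernel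

/-- Off-domain corner: centres below `(t0 + f0 + r0)/2` clip to an empty box. -/
example : GridTree.off.check 130 [] { toyBandBox with c0 := 118, c1 := 1184 / 10 } = true := by decide +kernel

/-- An unknown frame index fails. -/
example : (GridTree.frame 1).check 130 [toyBandFrame] toyBandBox = false := by decide +kernel

/-- Toy frame: a centre-wide H-description of the same band (centre `[118.4, 118.735]`, transverse `T_a ≥ 117.769`). -/
def toyWideFrame : StationRowsCert :=
  { toyBandFrame with
    lo := sextQ (118113 / 1000) (118113 / 1000) (117769 / 1000) (118113 / 1000) (117769 / 1000) (118113 / 1000),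
    loC := 1184 / 10 }

/-- A split on the centre: the lower part `C ≤ 118.4` is off-domain (clips empty), the upper part is the centre-wide frame. -/
example : (GridTree.splitC (1184 / 10) .off (.frame 0)).check 130 [toyWideFrame] { toyBandBox with c0 := 118 } = true := by
  decide +kernel

end Toy

end Summit.AtomisticToContinuum.Crystallization.Theorems.ChargedEnergyGapChartDial

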